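import Literature.Topology.FourManifolds.CappellShanesonClassNumberTwo
import Literature.Topology.FourManifolds.CappellShanesonGompfEquivalence
import HarnessLib

/-!
# Class number one at discriminant `4729`: Cappell–Shaneson matrices of trace `11` and `-6`
# are unique up to conjugacy (Aitchison–Rubinstein, Table 1, row `(11, -6)`)

Sibling of `CappellShanesonClassNumberOneLarge.lean` / `CappellShanesonClassNumberTwo.lean`,
serving

* the named fact `Literature.Barriers.SmoothPoincare4.aitchisonRubinstein1984_uniqueTraceClass_negSix_eleven`
  (`Literature/Barriers/SmoothPoincare4/CappellShanesonFamilyStandardProofs.lean`): "there is only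
  one conjugacy class with trace `r` (see [AR] for `r = -6, 11`)" (Gompf, Algebr. Geom. Topol. 10
  (2010), Thm. 3.2 and its proof), i.e. Aitchison–Rubinstein, Contemp. Math. 35 (1984), Appendix
  "Conjugacy in `SL(3, ℤ)`", Table 1, the row `a = 11, -6`: `Δ(f_a) = 4729`, prime, `R = R'`,
  `|C(R')| = 1` — whose discharge `…_holds` is the one-line corollary of
  `isConj_of_trace_eq_eleven_or_neg_six` below, filed next to the fact;
* Kim–Yamada's Theorem B in matrix form (`CappellShanesonGompfEquivalence.lean`,
  `GompfConjectureForTrace`): the base case `n = 11` of its proof ("`C(ℤ[Θₙ])` is trivial if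
  `3 ≤ n ≤ 9` or `n = 11`", Kim–Yamada, Kyungpook Math. J. 63 (2023), §6.1) and the trace `-6`,
  PROVED here: `gompfConjectureForTrace_eleven`, `gompfConjectureForTrace_neg_six`.

## The proof (as in `CappellShanesonClassNumberOneLarge.lean`; Marcus, *Number Fields*, Ch. 3,
## Thm. 27 and Ch. 5, after Thm. 37)

For a cubic number field `K` generated by a root `θ` of `f_a`, `a ∈ {11, -6}`:
`Δ(f_a) = 4729` is prime (`csDisc_sq_eleven_neg_six`), so `𝓞 K = ℤ[θ]` and `d_K = 4729`
(`discr_eq_csDisc_of_sq`, `CappellShanesonClassNumberTwo.lean`); the Minkowski bound is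
`⌊M_K⌋ ≤ 19` (`floor_minkowskiBound_le_cubic`, using only `r₂ ≤ 1`, `π > 3.14`); `f_a` has no root
modulo `p = 2, 3, 5, 7, 13, 19` (inert, `P = (p)` principal, `eq_span_of_no_root_of_sq`) and
exactly one root modulo `11` and `17` (`11² , 17² > 19`, so only the residue-degree-one primes
`(11, θ - c₀)`, `(17, θ - 2)` matter, `eq_span_pair_of_unique_root_of_sq`), with the certified
generators

* `a = 11` (`θ³ = 11θ² - 10θ + 1`): `(11, θ - 6) = (2θ - 1)` (`11 = (2θ - 1)(-19 + 42θ - 4θ²)`,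
  `θ - 6 = (2θ - 1)(10 - 21θ + 2θ²)`, norm `N(2θ - 1) = -11`) and `(17, θ - 2) = (θ - 2)`
  (`17 = (θ - 2)(-8 - 9θ + θ²)`);
* `a = -6` (`θ³ = -6θ² + 7θ + 1`): `(11, θ - 10) = (θ + 1)` (`11 = -(θ + 1)(-12 + 5θ + θ²)`,
  `θ - 10 = -(θ + 1)(11 - 5θ - θ²)`) and `(17, θ - 2) = (θ - 2)` (`17 = (θ - 2)(-9 - 8θ - θ²)`).

Hence `𝓞 K` is principal (`isPrincipalIdealRing_ringOfIntegers_eleven_neg_six`), so is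
`ℤ[X]/(f_a) ≅ ℤ[θ]` (`isPrincipalIdealRing_adjoinRoot_csPoly_eleven`, `…_neg_six`), and by the
class-number-one case of the Latimer–MacDuffee–Taussky correspondence
(`Literature.LinearAlgebra.Matrix.exists_isUnit_det_and_mul_eq_mul_of_charpoly_eq`) any two
Cappell–Shaneson matrices of trace `11` (resp. `-6`) are conjugate in `SL(3, ℤ)`
(`isConj_of_trace_eq_eleven_or_neg_six`).

## References

* [AitchisonRubinstein1984] I. R. Aitchison, J. H. Rubinstein, *Fibered knots and involutions on
  homotopy spheres*, Contemp. Math. 35 (1984) 1–74, Appendix "Conjugacy in `SL(3, ℤ)`", Table 1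
  (row `a = 11, -6`: `Δ = 4729`, prime, `R = R'`, `|C(R')| = 1`).
* [GompfAGT2010] R. E. Gompf, Algebr. Geom. Topol. 10 (2010) 1665–1681, Thm. 3.2 (proof: "see
  [AR] for `r = -6, 11`").
* [KimYamada2023] M. H. Kim, S. Yamada, Kyungpook Math. J. 63 (2023), §6.1 (proof of Thm. B:
  "`C(ℤ[Θₙ])` is trivial if `3 ≤ n ≤ 9` or `n = 11`").
* [Marcus2018] D. A. Marcus, *Number Fields*, 2nd ed., Ch. 3, Thm. 27; Ch. 5, Cor. 2 of Thm. 37.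
-/

noncomputable section

open Set Polynomial Module NumberField Ideal
open scoped NumberField MatrixGroups

namespace Literature.Topology.FourManifolds

/-! ### The discriminant `4729` -/

/-- `Δ(f₁₁) = 11·9·8·6 - 23 = 4729`. [cite: AitchisonRubinstein1984, Appendix, Table 1 (row a = 11, -6)] -/
theorem csDisc_eleven : csDisc 11 = 4729 := by
  decide

/-- `Δ(f₋₆) = 4729` (`Δ(f_a) = Δ(f_{5-a})`). [cite: AitchisonRubinstein1984, Appendix, Table 1 (row a = 11, -6)] -/
theorem csDisc_neg_six : csDisc (-6) = 4729 := by
  decide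

/-- `4729` is prime; in particular `Δ(f_a)`, `a ∈ {11, -6}`, admits no factorisation `r² e` with
`|e| > 2` and `r ≠ ±1` (Table 1: "Prime? YES"). [cite: AitchisonRubinstein1984, Appendix, Table 1 (row a = 11, -6)] -/
theorem csDisc_sq_eleven_neg_six {a : ℤ} (ha : a = 11 ∨ a = -6) :
    ∀ r e : ℤ, csDisc a = r ^ 2 * e → 2 < |e| → IsUnit r := by
  have h : csDisc a = 4729 := by
    rcases ha with rfl | rfl
    · exact csDisc_eleven
    · exact csDisc_neg_six
  rw [h]
  exact isUnit_of_eq_sq_mul (B := 68) (by decide) (by decide) (by decide)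

section Root

variable {K : Type*} [Field K] [NumberField K] {a : ℤ} {θ : K}

/-! ### Class number one of the cubic field of discriminant `4729` -/

/-- **Split primes with a certified generator are principal** (the `_of_sq` form of
`isPrincipal_of_unique_root`): if `f_a` has exactly one root `c₀` modulo `p`, `p² > U ≥ p ^ f_P`,
and `α` generates `(p, θ - c₀)`, then a prime `P` above `p` with `p ^ f_P ≤ U` is principal. [cite: Marcus2018, Ch. 3, Thm. 27] -/
theorem isPrincipal_of_unique_root_of_sq (hθ : aeval θ (csPoly a) = 0) (h3 : finrank ℚ K = 3)
    (hsq : ∀ r e : ℤ, csDisc a = r ^ 2 * e → 2 < |e| → IsUnit r) {p : ℕ} (hp : p.Prime)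
    {P : Ideal (𝓞 K)} (hP : P ∈ primesOver (span {(p : ℤ)}) (𝓞 K)) {U : ℕ}
    (hle : p ^ P.inertiaDeg ℤ ≤ U) {c₀ : ℤ}
    (hroot : ∀ c : ZMod p, c ^ 3 - (a : ZMod p) * c ^ 2 + ((a : ZMod p) - 1) * c - 1 = 0 →
      c = (c₀ : ZMod p))
    (hU : U < p ^ 2) {α : 𝓞 K}
    (hα : span {(p : 𝓞 K), thetaInt hθ - (c₀ : 𝓞 K)} = span {α}) :
    Submodule.IsPrincipal P := by
  rw [eq_span_pair_of_unique_root_of_sq hθ h3 hsq hp hP hle hroot hU, hα]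
  exact ⟨⟨α, by rw [Ideal.submodule_span_eq]⟩⟩

/-- **Class number one for `a ∈ {11, -6}` (proved).** The ring of integers of a cubic field
generated by a root of `f₁₁` or `f₋₆` is principal (Aitchison–Rubinstein, Table 1, row
`a = 11, -6`: `Δ = 4729`, `|C(R')| = 1`). Proof: `𝓞 K = ℤ[θ]`, `d_K = 4729`, `⌊M_K⌋ ≤ 19`; the
primes `2, 3, 5, 7, 13, 19` are inert; `11` and `17` have a single root, and the degree-one primes
above them are generated by `2θ - 1`, `θ - 2` (`a = 11`) resp. `θ + 1`, `θ - 2` (`a = -6`), with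
explicit cofactors. [cite: AitchisonRubinstein1984, Appendix, Table 1 (row a = 11, -6)] -/
theorem isPrincipalIdealRing_ringOfIntegers_eleven_neg_six (hθ : aeval θ (csPoly a) = 0)
    (h3 : finrank ℚ K = 3) (ha : a = 11 ∨ a = -6) : IsPrincipalIdealRing (𝓞 K) := by
  have hsq := csDisc_sq_eleven_neg_six ha
  have hdisc := discr_eq_csDisc_of_sq hθ h3 hsq
  have rel := thetaInt_rel hθ
  set t := thetaInt hθ with ht
  have hd : ((|NumberField.discr K| : ℤ) : ℝ) ≤ (4729 : ℕ) := by
    rw [hdisc]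
    rcases ha with rfl | rfl
    · rw [csDisc_eleven]; norm_num
    · rw [csDisc_neg_six]; norm_num
  have hfloor := floor_minkowskiBound_le_cubic h3 hd (s := 68.77) (U := 19) (by norm_num)
    (by norm_num) (by norm_num)
  refine RingOfIntegers.isPrincipalIdealRing_of_isPrincipal_of_pow_le_of_mem_primesOver_of_mem_Icc
    fun p hp hprime P hP hle => ?_
  have hpU : p ≤ 19 := (Finset.mem_Icc.mp hp).2.trans hfloor
  have hle' : p ^ P.inertiaDeg ℤ ≤ 19 := hle.trans hfloor
  have h1p : 1 ≤ p := (Finset.mem_Icc.mp hp).1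
  rcases ha with rfl | rfl
  · -- `a = 11`: `θ³ = 11θ² - 10θ + 1`
    have rel' : t ^ 3 - 11 * t ^ 2 + 10 * t - 1 = 0 := by push_cast at rel; linear_combination rel
    interval_cases p <;> first
      | (exfalso; revert hprime; decide)
      | exact ⟨⟨_, by rw [eq_span_of_no_root_of_sq hθ h3 hsq hprime hP (by decide),
          submodule_span_eq]⟩⟩
      | -- `p = 11`: root `6`, `(11, θ - 6) = (2θ - 1)`
        exact isPrincipal_of_unique_root_of_sq hθ h3 hsq hprime hP hle' (c₀ := 6) (by decide)
          (by norm_num) (α := 2 * t - 1) (span_pair_eq_span_singleton (u := 1) (v := 2)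
            (δ := -19 + 42 * t - 4 * t ^ 2) (ε := 10 - 21 * t + 2 * t ^ 2) (by push_cast; ring)
            (by push_cast; linear_combination (8 : 𝓞 K) * rel')
            (by push_cast; linear_combination (-4 : 𝓞 K) * rel'))
      | -- `p = 17`: root `2`, `(17, θ - 2) = (θ - 2)`
        exact isPrincipal_of_unique_root_of_sq hθ h3 hsq hprime hP hle' (c₀ := 2) (by decide)
          (by norm_num) (α := t - 2) (span_pair_eq_span_singleton (u := 0) (v := 1)
            (δ := -8 - 9 * t + t ^ 2) (ε := 1) (by push_cast; ring)
            (by push_cast; linear_combination (-1 : 𝓞 K) * rel') (by push_cast; ring))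
  · -- `a = -6`: `θ³ = -6θ² + 7θ + 1`
    have rel' : t ^ 3 + 6 * t ^ 2 - 7 * t - 1 = 0 := by push_cast at rel; linear_combination rel
    interval_cases p <;> first
      | (exfalso; revert hprime; decide)
      | exact ⟨⟨_, by rw [eq_span_of_no_root_of_sq hθ h3 hsq hprime hP (by decide),
          submodule_span_eq]⟩⟩
      | -- `p = 11`: root `10`, `(11, θ - 10) = (θ + 1)` (generator `-θ - 1`)
        exact isPrincipal_of_unique_root_of_sq hθ h3 hsq hprime hP hle' (c₀ := 10) (by decide)
          (by norm_num) (α := -t - 1) (span_pair_eq_span_singleton (u := -1) (v := -1)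
            (δ := -12 + 5 * t + t ^ 2) (ε := 11 - 5 * t - t ^ 2) (by push_cast; ring)
            (by push_cast; linear_combination rel')
            (by push_cast; linear_combination (-1 : 𝓞 K) * rel'))
      | -- `p = 17`: root `2`, `(17, θ - 2) = (θ - 2)`
        exact isPrincipal_of_unique_root_of_sq hθ h3 hsq hprime hP hle' (c₀ := 2) (by decide)
          (by norm_num) (α := t - 2) (span_pair_eq_span_singleton (u := 0) (v := 1)
            (δ := -9 - 8 * t - t ^ 2) (ε := 1) (by push_cast; ring)
            (by push_cast; linear_combination rel') (by push_cast; ring))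

/-- **From class number one of `K` to `ℤ[X]/(f_a)` principal**, under the square-factor hypothesis
on `Δ(f_a)` (`𝓞 K = ℤ[θ] ≅ ℤ[X]/(f_a)`; the version of
`isPrincipalIdealRing_adjoinRoot_csPoly_of_ringOfIntegers` with `isUnit_indexDet_csPB_of_sq`). [cite: Marcus2018, Ch. 2, Exercise 27(d),(e)] -/
theorem isPrincipalIdealRing_adjoinRoot_csPoly_of_sq (hθ : aeval θ (csPoly a) = 0)
    (h3 : finrank ℚ K = 3) (hsq : ∀ r e : ℤ, csDisc a = r ^ 2 * e → 2 < |e| → IsUnit r)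
    (hK : IsPrincipalIdealRing (𝓞 K)) : IsPrincipalIdealRing (AdjoinRoot (csPoly a)) := by
  rw [← minpoly_int_eq hθ]
  exact Literature.NumberTheory.NumberFields.isPrincipalIdealRing_adjoinRoot_minpoly_of_isUnit_indexDet
    (csPB hθ h3) (isIntegral_csPB_gen hθ h3) (isUnit_indexDet_csPB_of_sq hθ h3 hsq)

end Root

/-! ### `ℤ[X]/(f₁₁)` and `ℤ[X]/(f₋₆)` are principal ideal domains -/

/-- **`ℤ[θ₁₁] = ℤ[X]/(f₁₁)` is a principal ideal domain** (Table 1, row `a = 11`: `R = R'`,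
`|C(R')| = 1`), through the model `ℚ[x]/(f₁₁)`. [cite: AitchisonRubinstein1984, Appendix, Table 1 (row a = 11, -6)] -/
theorem isPrincipalIdealRing_adjoinRoot_csPoly_eleven : IsPrincipalIdealRing (AdjoinRoot (csPoly 11)) :=
  isPrincipalIdealRing_adjoinRoot_csPoly_of_sq (K := CSField 11) (aeval_root_csPoly 11)
    (finrank_CSField 11) (csDisc_sq_eleven_neg_six (Or.inl rfl))
    (isPrincipalIdealRing_ringOfIntegers_eleven_neg_six (aeval_root_csPoly 11) (finrank_CSField 11)
      (Or.inl rfl))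

/-- **`ℤ[θ₋₆] = ℤ[X]/(f₋₆)` is a principal ideal domain** (Table 1, row `a = -6`). [cite: AitchisonRubinstein1984, Appendix, Table 1 (row a = 11, -6)] -/
theorem isPrincipalIdealRing_adjoinRoot_csPoly_neg_six :
    IsPrincipalIdealRing (AdjoinRoot (csPoly (-6))) :=
  isPrincipalIdealRing_adjoinRoot_csPoly_of_sq (K := CSField (-6)) (aeval_root_csPoly (-6))
    (finrank_CSField (-6)) (csDisc_sq_eleven_neg_six (Or.inr rfl))
    (isPrincipalIdealRing_ringOfIntegers_eleven_neg_six (aeval_root_csPoly (-6))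
      (finrank_CSField (-6)) (Or.inr rfl))

/-! ### The conjugacy class at traces `11` and `-6` is unique -/

/-- **Aitchison–Rubinstein 1984, Table 1, row `(11, -6)`, with Latimer–MacDuffee–Taussky
(proved): a Cappell–Shaneson matrix of trace `11` or `-6` is unique up to conjugacy in
`SL(3, ℤ)`** ("there is only one conjugacy class with trace `r` (see [AR] for `r = -6, 11`)",
Gompf 2010, Thm. 3.2 and proof). Both matrices have characteristic polynomial `f_a`
(`charpoly_eq_csPoly`), `ℤ[X]/(f_a)` is a principal ideal domain, so the class-number-one case
of the correspondence (`exists_isUnit_det_and_mul_eq_mul_of_charpoly_eq`) conjugates them in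
`GL(3, ℤ)`, i.e. in `SL(3, ℤ)` (`isConj_iff_exists_isUnit_det`). [cite: AitchisonRubinstein1984, Appendix (Conjugacy in SL(3,Z)), Table 1 (row a = 11, -6)] [cite: GompfAGT2010, Thm. 3.2 (proof: r = -6, 11)] -/
theorem isConj_of_trace_eq_eleven_or_neg_six (A B : SL(3, ℤ))
    (hA : ((A : Matrix (Fin 3) (Fin 3) ℤ) - 1).det = 1)
    (hB : ((B : Matrix (Fin 3) (Fin 3) ℤ) - 1).det = 1)
    (htr : Matrix.trace (A : Matrix (Fin 3) (Fin 3) ℤ) = 11 ∨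
      Matrix.trace (A : Matrix (Fin 3) (Fin 3) ℤ) = -6)
    (hAB : Matrix.trace (B : Matrix (Fin 3) (Fin 3) ℤ) = Matrix.trace (A : Matrix (Fin 3) (Fin 3) ℤ)) :
    IsConj A B := by
  have hPIR : IsPrincipalIdealRing
      (AdjoinRoot (csPoly (Matrix.trace (A : Matrix (Fin 3) (Fin 3) ℤ)))) := by
    rcases htr with h | h <;> rw [h]
    · exact isPrincipalIdealRing_adjoinRoot_csPoly_eleven
    · exact isPrincipalIdealRing_adjoinRoot_csPoly_neg_six
  obtain ⟨P, hP, hPAB⟩ :=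
    Literature.LinearAlgebra.Matrix.exists_isUnit_det_and_mul_eq_mul_of_charpoly_eq
      (monic_csPoly _) (natDegree_csPoly _) (A : Matrix (Fin 3) (Fin 3) ℤ)
      (B : Matrix (Fin 3) (Fin 3) ℤ) (charpoly_eq_csPoly A hA)
      (by rw [charpoly_eq_csPoly B hB, hAB])
  exact (isConj_iff_exists_isUnit_det A B).mpr ⟨P, hP, hPAB⟩

/-! ### Gompf's conjecture for the traces `11` and `-6` -/

/-- **Gompf's conjecture is true for trace `11` (proved)**: a Cappell–Shaneson matrix of trace `11`
is conjugate to `A₉`, which is Gompf equivalent to `A₀` (Gompf 2010, proof of Thm. 3.2: "so `A`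
is conjugate to `A_{r-2}`, and the result follows from Example 3.1(a)"; Kim–Yamada 2023, §6.1:
"`C(ℤ[Θₙ])` is trivial if `3 ≤ n ≤ 9` or `n = 11`, and hence Conjecture 2 is true … for trace
11"). [cite: KimYamada2023, §6.1 (proof of Thm. B)] [cite: GompfAGT2010, Thm. 3.2 (proof)] -/
theorem gompfConjectureForTrace_eleven : GompfConjectureForTrace 11 := by
  intro A hdet htr
  have hc : IsConj (cappellShanesonMatrix 9) A :=
    isConj_of_trace_eq_eleven_or_neg_six _ A (det_cappellShanesonMatrix_sub_one 9) hdet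
      (Or.inl (by rw [trace_coe_cappellShanesonMatrix]; norm_num))
      (by rw [htr, trace_coe_cappellShanesonMatrix]; norm_num)
  exact (GompfEquiv.of_isConj hc.symm).trans (gompfEquiv_cappellShanesonMatrix_akbulutKirbyMatrix 9)

/-- **Gompf's conjecture is true for trace `-6` (proved)**: a Cappell–Shaneson matrix of trace
`-6` is conjugate to `A₋₈ ∼ A₀` (Gompf 2010, Thm. 3.2: "`-6 ≤ r ≤ 9`", proof: "see [AR] for
`r = -6, 11`"). [cite: GompfAGT2010, Thm. 3.2 (proof)] -/
theorem gompfConjectureForTrace_neg_six : GompfConjectureForTrace (-6) := by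
  intro A hdet htr
  have hc : IsConj (cappellShanesonMatrix (-8)) A :=
    isConj_of_trace_eq_eleven_or_neg_six _ A (det_cappellShanesonMatrix_sub_one (-8)) hdet
      (Or.inr (by rw [trace_coe_cappellShanesonMatrix]; norm_num))
      (by rw [htr, trace_coe_cappellShanesonMatrix]; norm_num)
  exact (GompfEquiv.of_isConj hc.symm).trans
    (gompfEquiv_cappellShanesonMatrix_akbulutKirbyMatrix (-8))

end Literature.Topology.FourManifolds

end
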